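import Literature.Analysis.FunctionSpaces.BesselJSqrtKernelDecay
import Mathlib.Analysis.SpecialFunctions.Gaussian.GaussianIntegral
import Mathlib.Analysis.SpecialFunctions.Pow.Asymptotics
import Mathlib.MeasureTheory.Integral.IntegralEqImproper
import HarnessLib

/-!
# Decay of `∫₀^∞ f(x) J₀(β√x) dx` for exponentially decaying `C²` functions: `≪ β^{-5/2}`

Topic `Analysis/FunctionSpaces` (namespace `Literature.Analysis.FunctionSpaces`), continuing
`BesselJSqrtKernelDecay.lean` (the compactly supported case: `∫₀^∞ g(x)J₀(β√x)dx = (4/β²)∫₀^∞ g''(x)·x·J₂(β√x)dx`,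
`|J₂(u)| ≤ 86u^{-1/2}`, and the exact antiderivatives `(√x·J₁(β√x))' = (β/2)J₀(β√x)`,
`(x·J₂(β√x))' = (β/2)√x·J₁(β√x)`).

Here the test function is NOT compactly supported: `f : ℝ → ℂ` twice differentiable on `ℝ` with
`‖f‖, ‖f'‖, ‖f''‖ ≤ A·e^{-δx}` on `x ≥ 0` (`δ > 0`). The same two integrations by parts, now on `(0, ∞)` with
Mathlib's `MeasureTheory.integral_Ioi_mul_deriv_eq_deriv_mul` (boundary terms: `√x·J₁(β√x)` and `x·J₂(β√x)`
vanish at `0⁺`; the decay kills them at `∞`), give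

* `integral_mul_besselJ_zero_sqrt_eq_of_exp_decay` — `∫₀^∞ f(x)J₀(β√x)dx = (4/β²)∫₀^∞ f''(x)·x·J₂(β√x)dx`;
* `norm_integral_mul_besselJ_zero_sqrt_le_of_exp_decay'` — `‖∫₀^∞ f(x)J₀(β√x)dx‖ ≤ 344·β^{-5/2}·∫₀^∞ x^{3/4}‖f''(x)‖dx`,
  and its `∃ K`-packaged form `norm_integral_mul_besselJ_zero_sqrt_le_of_exp_decay` (the shape consumed by the
  weighted exponential-polynomial approximation argument for the weight-one Voronoi formula
  [ConreyIwaniec2002, Proposition 3.1]: differences `g − f_N` of a `C²_c` test function and exponential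
  polynomials are exponentially decaying but not compactly supported);
* `integrableOn_rpow_mul_norm_of_exp_decay` — `x^{3/4}‖f''(x)‖` is integrable on `(0,∞)`;
* `exists_abs_besselJ_two_le` — `∃ K₂ > 0, |J₂(u)| ≤ K₂u^{-1/2}` (`u > 0`).

No new definitions; no named facts.

## References
* [ConreyIwaniec2002] B. Conrey, H. Iwaniec, Acta Arith. 103 (2002) 259–312, §3 (3.11)–(3.13), §4 (4.22)–(4.23).
* DLMF 10.6.6; G. N. Watson, *A Treatise on the Theory of Bessel Functions* (1944), §2.12, §7.21.
-/

noncomputable section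

open MeasureTheory Set Real intervalIntegral Filter
open scoped Topology

namespace Literature.Analysis.FunctionSpaces

/-! ### §4. Test functions with exponential decay on `[0, ∞)` (no compact support)

The same two integrations by parts on `(0, ∞)` (`MeasureTheory.integral_Ioi_mul_deriv_eq_deriv_mul`) for
`f : ℝ → ℂ` twice differentiable on `ℝ` with `f, f', f'' = O(e^{-δx})` on `x ≥ 0`: the boundary terms vanish at
`0⁺` because `√x·J₁(β√x)` and `x·J₂(β√x)` do, and at `∞` by the decay. This is the shape consumed by the weighted
exponential-polynomial approximation argument for the weight-one Voronoi formula (differences `g − f_N` of a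
`C²_c` test function and exponential polynomials are not compactly supported). -/

section ExpDecay

/-- `∃ K₂ > 0, |J₂(u)| ≤ K₂·u^{-1/2}` for all `u > 0` (the existential twin of `abs_besselJ_two_le`, `K₂ = 86`).
[cite: Iwaniec2002, Appendix B.4 (B.35)] -/
theorem exists_abs_besselJ_two_le :
    ∃ K₂ : ℝ, 0 < K₂ ∧ ∀ u : ℝ, 0 < u → |besselJ 2 u| ≤ K₂ * u ^ (-(1 / 2 : ℝ)) :=
  ⟨86, by norm_num, fun _ hu => abs_besselJ_two_le hu⟩

/-- `A·x^s·e^{-δx}` is integrable on `(0,∞)` for `s > -1`, `δ > 0` (Mathlib's Gamma-integral convergence). [folklore] -/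
private theorem integrableOn_const_mul_rpow_mul_exp_neg {s δ : ℝ} (hs : -1 < s) (hδ : 0 < δ) (A : ℝ) :
    IntegrableOn (fun x : ℝ => A * (x ^ s * Real.exp (-(δ * x)))) (Ioi 0) := by
  have h := integrableOn_rpow_mul_exp_neg_mul_rpow hs (le_refl (1 : ℝ)) hδ
  have h' : IntegrableOn (fun x : ℝ => x ^ s * Real.exp (-(δ * x))) (Ioi 0) := by
    refine h.congr_fun (fun x _ => ?_) measurableSet_Ioi
    simp only [Real.rpow_one, neg_mul]
  exact h'.const_mul A

/-- `A·x^s·e^{-δx} → 0` as `x → ∞` (`δ > 0`). [folklore] -/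
private theorem tendsto_const_mul_rpow_mul_exp_neg (s : ℝ) {δ : ℝ} (hδ : 0 < δ) (A : ℝ) :
    Tendsto (fun x : ℝ => A * (x ^ s * Real.exp (-(δ * x)))) atTop (𝓝 0) := by
  have h := tendsto_rpow_mul_exp_neg_mul_atTop_nhds_zero s δ hδ
  have h' : Tendsto (fun x : ℝ => x ^ s * Real.exp (-(δ * x))) atTop (𝓝 0) := by
    refine h.congr' (Eventually.of_forall fun x => ?_)
    rw [neg_mul]
  simpa using h'.const_mul A

/-- `‖√x·J₁(β√x)‖ ≤ x^{1/2}` for `x ≥ 0` (`|J₁| ≤ 1`). [folklore] -/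
private theorem norm_sqrt_mul_besselJ_one_le {β x : ℝ} (hx : 0 ≤ x) :
    ‖(((Real.sqrt x * besselJ 1 (β * Real.sqrt x)) : ℝ) : ℂ)‖ ≤ x ^ (1 / 2 : ℝ) := by
  rw [Complex.norm_real, Real.norm_eq_abs, abs_mul, abs_of_nonneg (Real.sqrt_nonneg _),
    Real.sqrt_eq_rpow]
  have h1 : |besselJ 1 (β * x ^ (1 / 2 : ℝ))| ≤ 1 := abs_besselJ_le_one_holds 1 _
  have h0 : 0 ≤ x ^ (1 / 2 : ℝ) := Real.rpow_nonneg hx _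
  calc x ^ (1 / 2 : ℝ) * |besselJ 1 (β * x ^ (1 / 2 : ℝ))| ≤ x ^ (1 / 2 : ℝ) * 1 := by gcongr
    _ = x ^ (1 / 2 : ℝ) := mul_one _

/-- `‖x·J₂(β√x)‖ ≤ x` for `x ≥ 0` (`|J₂| ≤ 1`). [folklore] -/
private theorem norm_mul_besselJ_two_le {β x : ℝ} (hx : 0 ≤ x) :
    ‖(((x * besselJ 2 (β * Real.sqrt x)) : ℝ) : ℂ)‖ ≤ x ^ (1 : ℝ) := by
  rw [Complex.norm_real, Real.norm_eq_abs, abs_mul, abs_of_nonneg hx, Real.rpow_one]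
  have h1 : |besselJ 2 (β * Real.sqrt x)| ≤ 1 := abs_besselJ_le_one_holds 2 _
  calc x * |besselJ 2 (β * Real.sqrt x)| ≤ x * 1 := by gcongr
    _ = x := mul_one _

variable {f f' f'' : ℝ → ℂ} {A δ β : ℝ}
  (hβ : 0 < β) (hδ : 0 < δ) (hf : ∀ x, HasDerivAt f (f' x) x) (hf' : ∀ x, HasDerivAt f' (f'' x) x)
  (hf'' : Continuous f'')
  (hbd : ∀ x, 0 ≤ x → ‖f x‖ ≤ A * Real.exp (-(δ * x)) ∧ ‖f' x‖ ≤ A * Real.exp (-(δ * x)) ∧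
    ‖f'' x‖ ≤ A * Real.exp (-(δ * x)))

include hf'' hbd in
/-- **Integrability of `x^{3/4}‖f''(x)‖` on `(0,∞)`** for continuous `f''` with `‖f''(x)‖ ≤ Ae^{-δx}` (`x ≥ 0`,
`δ > 0`) — the finiteness of the right-hand side of the `β^{-5/2}`-bound (4.23) for exponentially decaying test
functions. [cite: ConreyIwaniec2002, §4 (4.23); Proposition 3.1 (3.11)–(3.13)] -/
theorem integrableOn_rpow_mul_norm_of_exp_decay (hδ : 0 < δ) :
    IntegrableOn (fun x : ℝ => x ^ (3 / 4 : ℝ) * ‖f'' x‖) (Ioi 0) := by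
  refine (integrableOn_const_mul_rpow_mul_exp_neg (s := 3 / 4) (by norm_num) hδ A).mono' ?_ ?_
  · exact ((Real.continuous_rpow_const (by norm_num)).mul hf''.norm).aestronglyMeasurable
  · refine (ae_restrict_mem measurableSet_Ioi).mono fun x hx => ?_
    have hx0 : 0 ≤ x := le_of_lt hx
    rw [Real.norm_eq_abs, abs_mul, abs_of_nonneg (Real.rpow_nonneg hx0 _), abs_norm]
    calc x ^ (3 / 4 : ℝ) * ‖f'' x‖ ≤ x ^ (3 / 4 : ℝ) * (A * Real.exp (-(δ * x))) := by
          gcongr; exact (hbd x hx0).2.2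
      _ = A * (x ^ (3 / 4 : ℝ) * Real.exp (-(δ * x))) := by ring

include hβ hδ hf hf' hbd in
/-- First integration by parts on `(0, ∞)` under exponential decay:
`(β/2)∫₀^∞ f(x)J₀(β√x)dx = −∫₀^∞ f'(x)·√x·J₁(β√x)dx`. [folklore] -/
private theorem integral_Ioi_ibp_one_of_exp_decay :
    ∫ x in Ioi (0 : ℝ), f x * (((β / 2 * besselJ 0 (β * Real.sqrt x) : ℝ) : ℂ)) =
      -∫ x in Ioi (0 : ℝ), f' x * (((Real.sqrt x * besselJ 1 (β * Real.sqrt x) : ℝ) : ℂ)) := by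
  have hcontJ : ∀ n : ℕ, Continuous (besselJ n) := continuous_besselJ_holds
  have hfc : Continuous f := continuous_iff_continuousAt.mpr fun x => (hf x).continuousAt
  have hf'c : Continuous f' := continuous_iff_continuousAt.mpr fun x => (hf' x).continuousAt
  have hFc : Continuous fun y : ℝ => (((Real.sqrt y * besselJ 1 (β * Real.sqrt y) : ℝ) : ℂ)) :=
    Complex.continuous_ofReal.comp
      (Real.continuous_sqrt.mul ((hcontJ 1).comp (continuous_const.mul Real.continuous_sqrt)))
  have hv'c : Continuous fun y : ℝ => (((β / 2 * besselJ 0 (β * Real.sqrt y) : ℝ) : ℂ)) :=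
    Complex.continuous_ofReal.comp
      (continuous_const.mul ((hcontJ 0).comp (continuous_const.mul Real.continuous_sqrt)))
  have hv : ∀ x ∈ Ioi (0 : ℝ), HasDerivAt (fun y : ℝ => (((Real.sqrt y * besselJ 1 (β * Real.sqrt y) : ℝ) : ℂ)))
      (((β / 2 * besselJ 0 (β * Real.sqrt x) : ℝ) : ℂ)) x := fun x hx =>
    (hasDerivAt_sqrt_mul_besselJ_one hβ hx).ofReal_comp
  -- integrability of `f · v'` : majorant `A e^{-δx} · (β/2)`
  have huv' : IntegrableOn (fun x => f x * (((β / 2 * besselJ 0 (β * Real.sqrt x) : ℝ) : ℂ))) (Ioi 0) := by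
    have hm := (integrableOn_const_mul_rpow_mul_exp_neg (s := 0) (by norm_num) hδ (A * (β / 2)))
    refine hm.mono' (hfc.mul hv'c).aestronglyMeasurable ?_
    refine (ae_restrict_mem measurableSet_Ioi).mono fun x hx => ?_
    have hx0 : 0 ≤ x := le_of_lt hx
    rw [norm_mul, Complex.norm_real, Real.norm_eq_abs, abs_mul, abs_of_pos (by positivity : (0 : ℝ) < β / 2),
      Real.rpow_zero, one_mul]
    have hJ : |besselJ 0 (β * Real.sqrt x)| ≤ 1 := abs_besselJ_le_one_holds 0 _
    calc ‖f x‖ * (β / 2 * |besselJ 0 (β * Real.sqrt x)|) ≤ (A * Real.exp (-(δ * x))) * (β / 2 * 1) := by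
          gcongr
          · exact (norm_nonneg _).trans (hbd x hx0).1
          · exact (hbd x hx0).1
      _ = A * (β / 2) * Real.exp (-(δ * x)) := by ring
  -- integrability of `f' · F` : majorant `A e^{-δx} · x^{1/2}`
  have hu'v : IntegrableOn (fun x => f' x * (((Real.sqrt x * besselJ 1 (β * Real.sqrt x) : ℝ) : ℂ))) (Ioi 0) := by
    have hm := (integrableOn_const_mul_rpow_mul_exp_neg (s := 1 / 2) (by norm_num) hδ A)
    refine hm.mono' (hf'c.mul hFc).aestronglyMeasurable ?_
    refine (ae_restrict_mem measurableSet_Ioi).mono fun x hx => ?_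
    have hx0 : 0 ≤ x := le_of_lt hx
    rw [norm_mul]
    calc ‖f' x‖ * ‖(((Real.sqrt x * besselJ 1 (β * Real.sqrt x) : ℝ) : ℂ))‖
        ≤ (A * Real.exp (-(δ * x))) * x ^ (1 / 2 : ℝ) := by
          gcongr
          · exact (norm_nonneg _).trans (hbd x hx0).2.1
          · exact (hbd x hx0).2.1
          · exact norm_sqrt_mul_besselJ_one_le hx0
      _ = A * (x ^ (1 / 2 : ℝ) * Real.exp (-(δ * x))) := by ring
  -- boundary terms
  have h_zero : Tendsto (fun x => f x * (((Real.sqrt x * besselJ 1 (β * Real.sqrt x) : ℝ) : ℂ)))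
      (𝓝[>] (0 : ℝ)) (𝓝 0) := by
    exact tendsto_nhdsWithin_of_tendsto_nhds ((hfc.mul hFc).tendsto' 0 0 (by simp))
  have h_infty : Tendsto (fun x => f x * (((Real.sqrt x * besselJ 1 (β * Real.sqrt x) : ℝ) : ℂ)))
      atTop (𝓝 0) := by
    refine squeeze_zero_norm' ?_ (tendsto_const_mul_rpow_mul_exp_neg (1 / 2) hδ A)
    filter_upwards [eventually_ge_atTop (0 : ℝ)] with x hx0
    rw [norm_mul]
    calc ‖f x‖ * ‖(((Real.sqrt x * besselJ 1 (β * Real.sqrt x) : ℝ) : ℂ))‖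
        ≤ (A * Real.exp (-(δ * x))) * x ^ (1 / 2 : ℝ) := by
          gcongr
          · exact (norm_nonneg _).trans (hbd x hx0).1
          · exact (hbd x hx0).1
          · exact norm_sqrt_mul_besselJ_one_le hx0
      _ = A * (x ^ (1 / 2 : ℝ) * Real.exp (-(δ * x))) := by ring
  have h := MeasureTheory.integral_Ioi_mul_deriv_eq_deriv_mul (fun x _ => hf x) hv huv' hu'v h_zero h_infty
  rw [h]
  simp

include hβ hδ hf' hf'' hbd in
/-- Second integration by parts on `(0, ∞)` under exponential decay:
`(β/2)∫₀^∞ f'(x)·√x·J₁(β√x)dx = −∫₀^∞ f''(x)·x·J₂(β√x)dx`. [folklore] -/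
private theorem integral_Ioi_ibp_two_of_exp_decay :
    ∫ x in Ioi (0 : ℝ), f' x * (((β / 2 * (Real.sqrt x * besselJ 1 (β * Real.sqrt x)) : ℝ) : ℂ)) =
      -∫ x in Ioi (0 : ℝ), f'' x * (((x * besselJ 2 (β * Real.sqrt x) : ℝ) : ℂ)) := by
  have hcontJ : ∀ n : ℕ, Continuous (besselJ n) := continuous_besselJ_holds
  have hf'c : Continuous f' := continuous_iff_continuousAt.mpr fun x => (hf' x).continuousAt
  have hGc : Continuous fun y : ℝ => (((y * besselJ 2 (β * Real.sqrt y) : ℝ) : ℂ)) :=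
    Complex.continuous_ofReal.comp
      (continuous_id.mul ((hcontJ 2).comp (continuous_const.mul Real.continuous_sqrt)))
  have hv'c : Continuous fun y : ℝ => (((β / 2 * (Real.sqrt y * besselJ 1 (β * Real.sqrt y)) : ℝ) : ℂ)) :=
    Complex.continuous_ofReal.comp (continuous_const.mul
      (Real.continuous_sqrt.mul ((hcontJ 1).comp (continuous_const.mul Real.continuous_sqrt))))
  have hv : ∀ x ∈ Ioi (0 : ℝ), HasDerivAt (fun y : ℝ => (((y * besselJ 2 (β * Real.sqrt y) : ℝ) : ℂ)))
      (((β / 2 * (Real.sqrt x * besselJ 1 (β * Real.sqrt x)) : ℝ) : ℂ)) x := fun x hx =>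
    (hasDerivAt_mul_besselJ_two_sqrt hβ hx).ofReal_comp
  -- integrability of `f' · v'` : majorant `A (β/2) e^{-δx} x^{1/2}`
  have huv' : IntegrableOn
      (fun x => f' x * (((β / 2 * (Real.sqrt x * besselJ 1 (β * Real.sqrt x)) : ℝ) : ℂ))) (Ioi 0) := by
    have hm := (integrableOn_const_mul_rpow_mul_exp_neg (s := 1 / 2) (by norm_num) hδ (A * (β / 2)))
    refine hm.mono' (hf'c.mul hv'c).aestronglyMeasurable ?_
    refine (ae_restrict_mem measurableSet_Ioi).mono fun x hx => ?_
    have hx0 : 0 ≤ x := le_of_lt hx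
    have hsplit : (((β / 2 * (Real.sqrt x * besselJ 1 (β * Real.sqrt x)) : ℝ) : ℂ)) =
        ((β / 2 : ℝ) : ℂ) * (((Real.sqrt x * besselJ 1 (β * Real.sqrt x) : ℝ) : ℂ)) := by push_cast; ring
    rw [hsplit, norm_mul, norm_mul, Complex.norm_real, Real.norm_of_nonneg (by positivity : (0 : ℝ) ≤ β / 2)]
    calc ‖f' x‖ * (β / 2 * ‖(((Real.sqrt x * besselJ 1 (β * Real.sqrt x) : ℝ) : ℂ))‖)
        ≤ (A * Real.exp (-(δ * x))) * (β / 2 * x ^ (1 / 2 : ℝ)) := by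
          gcongr
          · exact (norm_nonneg _).trans (hbd x hx0).2.1
          · exact (hbd x hx0).2.1
          · exact norm_sqrt_mul_besselJ_one_le hx0
      _ = A * (β / 2) * (x ^ (1 / 2 : ℝ) * Real.exp (-(δ * x))) := by ring
  -- integrability of `f'' · G` : majorant `A e^{-δx} x`
  have hu'v : IntegrableOn (fun x => f'' x * (((x * besselJ 2 (β * Real.sqrt x) : ℝ) : ℂ))) (Ioi 0) := by
    have hm := (integrableOn_const_mul_rpow_mul_exp_neg (s := 1) (by norm_num) hδ A)
    refine hm.mono' (hf''.mul hGc).aestronglyMeasurable ?_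
    refine (ae_restrict_mem measurableSet_Ioi).mono fun x hx => ?_
    have hx0 : 0 ≤ x := le_of_lt hx
    rw [norm_mul]
    calc ‖f'' x‖ * ‖(((x * besselJ 2 (β * Real.sqrt x) : ℝ) : ℂ))‖
        ≤ (A * Real.exp (-(δ * x))) * x ^ (1 : ℝ) := by
          gcongr
          · exact (norm_nonneg _).trans (hbd x hx0).2.2
          · exact (hbd x hx0).2.2
          · exact norm_mul_besselJ_two_le hx0
      _ = A * (x ^ (1 : ℝ) * Real.exp (-(δ * x))) := by ring
  have h_zero : Tendsto (fun x => f' x * (((x * besselJ 2 (β * Real.sqrt x) : ℝ) : ℂ)))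
      (𝓝[>] (0 : ℝ)) (𝓝 0) := by
    exact tendsto_nhdsWithin_of_tendsto_nhds ((hf'c.mul hGc).tendsto' 0 0 (by simp))
  have h_infty : Tendsto (fun x => f' x * (((x * besselJ 2 (β * Real.sqrt x) : ℝ) : ℂ))) atTop (𝓝 0) := by
    refine squeeze_zero_norm' ?_ (tendsto_const_mul_rpow_mul_exp_neg 1 hδ A)
    filter_upwards [eventually_ge_atTop (0 : ℝ)] with x hx0
    rw [norm_mul]
    calc ‖f' x‖ * ‖(((x * besselJ 2 (β * Real.sqrt x) : ℝ) : ℂ))‖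
        ≤ (A * Real.exp (-(δ * x))) * x ^ (1 : ℝ) := by
          gcongr
          · exact (norm_nonneg _).trans (hbd x hx0).2.1
          · exact (hbd x hx0).2.1
          · exact norm_mul_besselJ_two_le hx0
      _ = A * (x ^ (1 : ℝ) * Real.exp (-(δ * x))) := by ring
  have h := MeasureTheory.integral_Ioi_mul_deriv_eq_deriv_mul (fun x _ => hf' x) hv huv' hu'v h_zero h_infty
  rw [h]
  simp

include hβ hδ hf hf' hf'' hbd in
/-- **`∫₀^∞ f(x)J₀(β√x)dx = (4/β²)∫₀^∞ f''(x)·x·J₂(β√x)dx` under exponential decay**: `β > 0`, `f : ℝ → ℂ` with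
`f' `, `f''` its first two derivatives everywhere, `f''` continuous, and `‖f‖, ‖f'‖, ‖f''‖ ≤ Ae^{-δx}` on `x ≥ 0`
(`δ > 0`). [cite: ConreyIwaniec2002, Proposition 3.1 (3.11)–(3.13)] -/
theorem integral_mul_besselJ_zero_sqrt_eq_of_exp_decay :
    ∫ x in Ioi (0 : ℝ), f x * ((besselJ 0 (β * Real.sqrt x) : ℝ) : ℂ) =
      (4 / β ^ 2 : ℂ) * ∫ x in Ioi (0 : ℝ), f'' x * (((x * besselJ 2 (β * Real.sqrt x) : ℝ) : ℂ)) := by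
  have h1 := integral_Ioi_ibp_one_of_exp_decay hβ hδ hf hf' hbd
  have h2 := integral_Ioi_ibp_two_of_exp_decay hβ hδ hf' hf'' hbd
  have hβ0 : (β : ℂ) ≠ 0 := by exact_mod_cast hβ.ne'
  have e1 : ∫ x in Ioi (0 : ℝ), f x * ((besselJ 0 (β * Real.sqrt x) : ℝ) : ℂ) =
      (2 / β : ℂ) * ∫ x in Ioi (0 : ℝ), f x * (((β / 2 * besselJ 0 (β * Real.sqrt x) : ℝ) : ℂ)) := by
    rw [← MeasureTheory.integral_const_mul]
    congr 1
    funext x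
    push_cast
    field_simp
  have e2 : ∫ x in Ioi (0 : ℝ), f' x * (((Real.sqrt x * besselJ 1 (β * Real.sqrt x) : ℝ) : ℂ)) =
      (2 / β : ℂ) * ∫ x in Ioi (0 : ℝ),
        f' x * (((β / 2 * (Real.sqrt x * besselJ 1 (β * Real.sqrt x)) : ℝ) : ℂ)) := by
    rw [← MeasureTheory.integral_const_mul]
    congr 1
    funext x
    push_cast
    field_simp
  rw [e1, h1, e2, h2]
  field_simp
  ring

include hβ hδ hf hf' hf'' hbd in
/-- **`‖∫₀^∞ f(x)J₀(β√x)dx‖ ≤ 344·β^{-5/2}·∫₀^∞ x^{3/4}‖f''(x)‖dx` under exponential decay** (hypotheses of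
`integral_mul_besselJ_zero_sqrt_eq_of_exp_decay`). [cite: ConreyIwaniec2002, §4 (4.23); Proposition 3.1 (3.11)] -/
theorem norm_integral_mul_besselJ_zero_sqrt_le_of_exp_decay' :
    ‖∫ x in Ioi (0 : ℝ), f x * ((besselJ 0 (β * Real.sqrt x) : ℝ) : ℂ)‖ ≤
      344 * β ^ (-(5 / 2 : ℝ)) * ∫ x in Ioi (0 : ℝ), x ^ (3 / 4 : ℝ) * ‖f'' x‖ := by
  rw [integral_mul_besselJ_zero_sqrt_eq_of_exp_decay hβ hδ hf hf' hf'' hbd, norm_mul]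
  have hn4 : ‖(4 / β ^ 2 : ℂ)‖ = 4 / β ^ 2 := by
    rw [norm_div, Complex.norm_pow, Complex.norm_real, Real.norm_of_nonneg hβ.le]
    simp
  rw [hn4]
  have hpt : ∀ x ∈ Ioi (0 : ℝ),
      ‖f'' x * (((x * besselJ 2 (β * Real.sqrt x) : ℝ) : ℂ))‖ ≤
        86 * β ^ (-(1 / 2 : ℝ)) * (x ^ (3 / 4 : ℝ) * ‖f'' x‖) := by
    intro x hx
    have hx0 : 0 < x := hx
    have hsx : 0 < Real.sqrt x := Real.sqrt_pos.mpr hx0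
    rw [norm_mul, Complex.norm_real, Real.norm_eq_abs, abs_mul, abs_of_pos hx0]
    have hJ := abs_besselJ_two_le (u := β * Real.sqrt x) (by positivity)
    have hsplit : (β * Real.sqrt x) ^ (-(1 / 2 : ℝ)) = β ^ (-(1 / 2 : ℝ)) * x ^ (-(1 / 4 : ℝ)) := by
      rw [Real.mul_rpow hβ.le hsx.le, Real.sqrt_eq_rpow, ← Real.rpow_mul hx0.le]
      norm_num
    have hx34 : x * x ^ (-(1 / 4 : ℝ)) = x ^ (3 / 4 : ℝ) := by
      conv_lhs => rw [show x * x ^ (-(1 / 4 : ℝ)) = x ^ (1 : ℝ) * x ^ (-(1 / 4 : ℝ)) by rw [Real.rpow_one]]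
      rw [← Real.rpow_add hx0]
      norm_num
    calc ‖f'' x‖ * (x * |besselJ 2 (β * Real.sqrt x)|)
        ≤ ‖f'' x‖ * (x * (86 * (β * Real.sqrt x) ^ (-(1 / 2 : ℝ)))) := by gcongr
      _ = 86 * β ^ (-(1 / 2 : ℝ)) * ((x * x ^ (-(1 / 4 : ℝ))) * ‖f'' x‖) := by
          rw [hsplit]; ring
      _ = 86 * β ^ (-(1 / 2 : ℝ)) * (x ^ (3 / 4 : ℝ) * ‖f'' x‖) := by rw [hx34]
  have hI : ‖∫ x in Ioi (0 : ℝ), f'' x * (((x * besselJ 2 (β * Real.sqrt x) : ℝ) : ℂ))‖ ≤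
      ∫ x in Ioi (0 : ℝ), 86 * β ^ (-(1 / 2 : ℝ)) * (x ^ (3 / 4 : ℝ) * ‖f'' x‖) := by
    refine norm_integral_le_of_norm_le ?_ ((ae_restrict_mem measurableSet_Ioi).mono hpt)
    exact (integrableOn_rpow_mul_norm_of_exp_decay hf'' hbd hδ).const_mul _
  rw [MeasureTheory.integral_const_mul] at hI
  have hb2 : 4 / β ^ 2 * (86 * β ^ (-(1 / 2 : ℝ))) = 344 * β ^ (-(5 / 2 : ℝ)) := by
    have h1 : β ^ (-(5 / 2 : ℝ)) = β ^ (-(2 : ℝ)) * β ^ (-(1 / 2 : ℝ)) := by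
      rw [← Real.rpow_add hβ]; norm_num
    have h2 : β ^ (-(2 : ℝ)) = (β ^ 2)⁻¹ := by
      rw [Real.rpow_neg hβ.le, Real.rpow_two]
    rw [h1, h2]
    ring
  calc 4 / β ^ 2 * ‖∫ x in Ioi (0 : ℝ), f'' x * (((x * besselJ 2 (β * Real.sqrt x) : ℝ) : ℂ))‖
      ≤ 4 / β ^ 2 * (86 * β ^ (-(1 / 2 : ℝ)) * ∫ x in Ioi (0 : ℝ), x ^ (3 / 4 : ℝ) * ‖f'' x‖) := by
        gcongr
    _ = 344 * β ^ (-(5 / 2 : ℝ)) * ∫ x in Ioi (0 : ℝ), x ^ (3 / 4 : ℝ) * ‖f'' x‖ := by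
        rw [← mul_assoc, hb2]

/-- **`J₀`-decay for exponentially decaying `C²` functions, packaged with an existential constant** (the shape
consumed by the weighted exponential-polynomial approximation argument for the weight-one Voronoi formula,
[ConreyIwaniec2002, Proposition 3.1]): there is `K > 0` (`K = 344`) such that for all `β > 0` and all
`f : ℝ → ℂ` with derivatives `f'`, `f''` everywhere, `f''` continuous, `‖f‖, ‖f'‖, ‖f''‖ ≤ Ae^{-δx}` on `x ≥ 0`
(`δ > 0`): `‖∫₀^∞ f(x)J₀(β√x)dx‖ ≤ K·β^{-5/2}·∫₀^∞ x^{3/4}‖f''(x)‖dx`.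
[cite: ConreyIwaniec2002, §4 (4.23); Proposition 3.1 (3.11)–(3.13)] -/
theorem norm_integral_mul_besselJ_zero_sqrt_le_of_exp_decay :
    ∃ K : ℝ, 0 < K ∧ ∀ (β : ℝ), 0 < β → ∀ (f f' f'' : ℝ → ℂ) (A δ : ℝ), 0 < δ →
      (∀ x, HasDerivAt f (f' x) x) → (∀ x, HasDerivAt f' (f'' x) x) → Continuous f'' →
      (∀ x, 0 ≤ x → ‖f x‖ ≤ A * Real.exp (-(δ * x)) ∧ ‖f' x‖ ≤ A * Real.exp (-(δ * x)) ∧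
        ‖f'' x‖ ≤ A * Real.exp (-(δ * x))) →
      ‖∫ x in Set.Ioi (0 : ℝ), f x * ((besselJ 0 (β * Real.sqrt x) : ℝ) : ℂ)‖ ≤
        K * β ^ (-(5 / 2 : ℝ)) * ∫ x in Set.Ioi (0 : ℝ), x ^ (3 / 4 : ℝ) * ‖f'' x‖ :=
  ⟨344, by norm_num, fun _ hβ _ _ _ _ _ hδ hf hf' hf'' hbd =>
    norm_integral_mul_besselJ_zero_sqrt_le_of_exp_decay' hβ hδ hf hf' hf'' hbd⟩

end ExpDecay

end Literature.Analysis.FunctionSpaces
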